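import Summits.AtomisticToContinuum.HydrodynamicLimit.Theorems.LambertianContactSwapLambertianEulerTailsZero
import Summits.AtomisticToContinuum.HydrodynamicLimit.Theorems.JParityClosureKineticEnergyTailsApriori
import HarnessLib

/-!
# Line `tail-rate`, stub `stub_initialTails` (crux `TwoClocks.TransferEntropyClock`, stmt-AtomisticToContinuum-16625)

Registered stub `stub_initialTails` of the lead's skeleton (S_G1; verbatim the registered stub
`stub_initialTails` of item stmt-AtomisticToContinuum-14415 `UGibbsSRBRigidity.GaussianTails`): the
`t = 0` input of the Gaussian-tails node — **sub-Gaussian speed tails under the local Gibbs law**,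
uniformly in the reduced diameter `σ` (ALL real `σ`), the particle number `N + 1`, the flow `Φ`
(which only fixes the phase space, `localGibbsLaw_eq`) and the level `k`:

  `∑ᵢ λ_N {k ≤ ‖vᵢ‖} ≤ (N + 1) · C · e^{-κ k²}`,  `λ_N = localGibbsLaw σ a₀ u₀ θ₀ N Φ`.

## Proof

Given the positions, the local Gibbs velocities are independent Gaussians `N(u₀(xᵢ), θ₀(xᵢ) id)`
(disintegration `lintegral_localGibbsMeasure`), and the position marginal has total mass
`Z_pos⁻¹ · Z_pos ≤ 1` for EVERY `σ` (`localGibbsMeasure_univ`, landed as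
`Theorems.localGibbsMeasure_univ_le_one`; it is `1` when `Z_pos > 0` and `0` otherwise).  The landed uniform one-body exponential moment
`LambertianContactSwapLambertianEulerTailsZero.tailsZero_exists_lintegral_exp_gaussMeasure_le`
(Fernique + compactness of `𝕋³`) gives `a > 0`, `K` with `∫ e^{a‖v‖²} dN(u₀ x, θ₀ x) ≤ K` for all
`x`, whence `E_{λ_N} e^{a‖vᵢ‖²} ≤ K` for every particle `i` and every `σ`; the pointwise bound
`𝟙{k ≤ ‖v‖} ≤ e^{a‖v‖²} e^{-a k²}` (Chebyshev–Markov) gives `λ_N{k ≤ ‖vᵢ‖} ≤ K e^{-a k²}`, and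
summing over the `N + 1` particles closes the stub with `κ = a`, `C = K`.

References: H. Spohn, *Large Scale Dynamics of Interacting Particles* (1991), Part I §2.3;
X. Fernique, C. R. Acad. Sci. Paris 270 (1970).
-/

noncomputable section

open scoped BigOperators Topology ENNReal
open MeasureTheory ProbabilityTheory Filter Set
open Literature.MathematicalPhysics.KineticTheory
open Literature.Analysis.FluidPDE
open Summit.AtomisticToContinuum.HydrodynamicLimit.Theorems.LambertianContactSwapLambertianEulerTailsZero

namespace Summit.AtomisticToContinuum.HydrodynamicLimit.Theorems.TransferEntropyClockInitialTails

variable {a₀ θ₀ : T3 → ℝ} {u₀ : T3 → V3}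

/-! ## Total mass of the local Gibbs measure, for every `σ` -/

/-- **The normalised position weight integrates to at most one, for every `σ`.**  The position
marginal `Z⁻¹ 𝟙_{no overlap} ∏ a₀(xᵢ) dx` of the local Gibbs measure has total mass
`Z_pos⁻¹ · Z_pos ≤ 1`: `lintegral_localGibbsMeasure` with `G = 1` (the Gaussian velocity law given
the positions is a probability measure) and the landed `Theorems.localGibbsMeasure_univ_le_one`
(`JParityClosureKineticEnergyTailsApriori`). -/
theorem lintegral_posWeight_le_one (ha : Continuous a₀) (hθ : Continuous θ₀) (hu : Continuous u₀)
    (ha0 : ∀ x, 0 ≤ a₀ x) (hθ0 : ∀ x, 0 < θ₀ x) (σ : ℝ) (N : ℕ) :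
    ∫⁻ x, ENNReal.ofReal ((canonicalPartition (Torus.geometry (Fin 3)) (hsDiameter σ N) (N + 1)
        (localGibbsProfile a₀ u₀ θ₀))⁻¹ * posWeight a₀ (hsDiameter σ N) (N + 1) x) ≤ 1 := by
  have h := lintegral_localGibbsMeasure ha hθ hu ha0 hθ0 σ N (G := fun _ => 1) measurable_const
  simp only [lintegral_const, measure_univ, mul_one, one_mul] at h
  rw [← h]
  exact localGibbsMeasure_univ_le_one ha hθ hu ha0 hθ0 σ N

/-! ## Exponential velocity moments under the local Gibbs measure, for every `σ` -/

-- adapted from Theorems/LambertianContactSwapLambertianEulerTailsZero.lean (there under `σ ≤ 1/2`)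
/-- **Per-particle exponential moment under the local Gibbs measure, every `σ`.**  If the
one-body bound `∫ e^{a‖v‖²} dN(u₀(x), θ₀(x) id) ≤ K` holds uniformly in `x ∈ 𝕋³`, then for every
`σ`, `N` and particle `i`: `E_{λ_N} e^{a‖vᵢ‖²} ≤ K` — disintegrate `λ_N` into positions and
independent Gaussian velocities (`lintegral_localGibbsMeasure`), evaluate the `i`-th Gaussian
factor (`measurePreserving_eval`) and use that the position marginal has mass `≤ 1`
(`lintegral_posWeight_le_one`). -/
theorem lintegral_exp_localGibbsMeasure_le (ha : Continuous a₀) (hθ : Continuous θ₀)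
    (hu : Continuous u₀) (ha0 : ∀ x, 0 ≤ a₀ x) (hθ0 : ∀ x, 0 < θ₀ x) {a : ℝ} {K : ℝ≥0∞}
    (hK : ∀ x : T3, ∫⁻ v, ENNReal.ofReal (Real.exp (a * ‖v‖ ^ 2)) ∂gaussMeasure (u₀ x) (θ₀ x) ≤ K)
    (σ : ℝ) (N : ℕ) (i : Fin (N + 1)) :
    ∫⁻ z, ENNReal.ofReal (Real.exp (a * ‖(z i).2‖ ^ 2)) ∂(localGibbsMeasure σ a₀ u₀ θ₀ N) ≤ K := by
  have hg : Measurable fun w : V3 => ENNReal.ofReal (Real.exp (a * ‖w‖ ^ 2)) :=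
    (Real.measurable_exp.comp ((measurable_norm.pow_const 2).const_mul a)).ennreal_ofReal
  have hG : Measurable fun z : Config (N + 1) (Fin 3) T3 =>
      ENNReal.ofReal (Real.exp (a * ‖(z i).2‖ ^ 2)) :=
    hg.comp (measurable_pi_apply i).snd
  have hZm : Measurable fun x : Fin (N + 1) → T3 => ENNReal.ofReal
      ((canonicalPartition (Torus.geometry (Fin 3)) (hsDiameter σ N) (N + 1)
        (localGibbsProfile a₀ u₀ θ₀))⁻¹ * posWeight a₀ (hsDiameter σ N) (N + 1) x) :=
    ((measurable_posWeight ha _ _).const_mul _).ennreal_ofReal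
  have hB : ∀ x : Fin (N + 1) → T3,
      ∫⁻ v, ENNReal.ofReal (Real.exp (a * ‖(zipConfig (x, v) i).2‖ ^ 2)) ∂velMeasure u₀ θ₀ x
        ≤ K := by
    intro x
    simp only [zipConfig_apply]
    have hmp : MeasurePreserving (Function.eval i) (velMeasure u₀ θ₀ x)
        (gaussMeasure (u₀ (x i)) (θ₀ (x i))) := by
      unfold velMeasure
      exact measurePreserving_eval _ i
    calc ∫⁻ v, ENNReal.ofReal (Real.exp (a * ‖v i‖ ^ 2)) ∂velMeasure u₀ θ₀ x
        = ∫⁻ w, ENNReal.ofReal (Real.exp (a * ‖w‖ ^ 2)) ∂gaussMeasure (u₀ (x i)) (θ₀ (x i)) :=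
          hmp.lintegral_comp hg
      _ ≤ K := hK (x i)
  rw [lintegral_localGibbsMeasure ha hθ hu ha0 hθ0 σ N hG]
  refine (lintegral_mono fun x => mul_le_mul_right (hB x) _).trans ?_
  rw [lintegral_mul_const _ hZm]
  calc (∫⁻ x, ENNReal.ofReal ((canonicalPartition (Torus.geometry (Fin 3)) (hsDiameter σ N) (N + 1)
          (localGibbsProfile a₀ u₀ θ₀))⁻¹ * posWeight a₀ (hsDiameter σ N) (N + 1) x)) * K
      ≤ 1 * K := mul_le_mul' (lintegral_posWeight_le_one ha hθ hu ha0 hθ0 σ N) le_rfl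
    _ = K := one_mul K

/-! ## Sub-Gaussian speed tails, per particle -/

/-- **Chebyshev–Markov: sub-Gaussian speed tail of one particle under the local Gibbs measure,
every `σ`.**  With the one-body bound `∫ e^{a‖v‖²} dN(u₀(x), θ₀(x) id) ≤ K` (`a ≥ 0`), for every
`σ`, `N`, particle `i` and level `k`: `λ_N{k ≤ ‖vᵢ‖} ≤ K · e^{-a k²}` — the pointwise bound
`𝟙{k ≤ ‖v‖} ≤ e^{a‖v‖²} · e^{-a k²}` integrated against `λ_N` and
`lintegral_exp_localGibbsMeasure_le`. -/
theorem localGibbsMeasure_speed_ge_le (ha : Continuous a₀) (hθ : Continuous θ₀)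
    (hu : Continuous u₀) (ha0 : ∀ x, 0 ≤ a₀ x) (hθ0 : ∀ x, 0 < θ₀ x) {a : ℝ} (ha_nn : 0 ≤ a)
    {K : ℝ≥0∞}
    (hK : ∀ x : T3, ∫⁻ v, ENNReal.ofReal (Real.exp (a * ‖v‖ ^ 2)) ∂gaussMeasure (u₀ x) (θ₀ x) ≤ K)
    (σ : ℝ) (N : ℕ) (i : Fin (N + 1)) (k : ℕ) :
    localGibbsMeasure σ a₀ u₀ θ₀ N {z | (k : ℝ) ≤ ‖(z i).2‖} ≤
      K * ENNReal.ofReal (Real.exp (-(a * (k : ℝ) ^ 2))) := by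
  have hS : MeasurableSet {z : Config (N + 1) (Fin 3) T3 | (k : ℝ) ≤ ‖(z i).2‖} :=
    measurableSet_le measurable_const (measurable_pi_apply i).snd.norm
  have hG : Measurable fun z : Config (N + 1) (Fin 3) T3 =>
      ENNReal.ofReal (Real.exp (a * ‖(z i).2‖ ^ 2)) :=
    (Real.measurable_exp.comp ((measurable_norm.pow_const 2).const_mul a)).ennreal_ofReal.comp
      (measurable_pi_apply i).snd
  rw [← lintegral_indicator_one hS]
  calc ∫⁻ z, {z : Config (N + 1) (Fin 3) T3 | (k : ℝ) ≤ ‖(z i).2‖}.indicator 1 z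
        ∂(localGibbsMeasure σ a₀ u₀ θ₀ N)
      ≤ ∫⁻ z, ENNReal.ofReal (Real.exp (a * ‖(z i).2‖ ^ 2)) *
          ENNReal.ofReal (Real.exp (-(a * (k : ℝ) ^ 2))) ∂(localGibbsMeasure σ a₀ u₀ θ₀ N) := by
        refine lintegral_mono fun z => ?_
        by_cases hz : z ∈ {z : Config (N + 1) (Fin 3) T3 | (k : ℝ) ≤ ‖(z i).2‖}
        · rw [indicator_of_mem hz, Pi.one_apply, ← ENNReal.ofReal_mul (Real.exp_pos _).le,
            ← Real.exp_add]
          refine ENNReal.one_le_ofReal.2 (Real.one_le_exp ?_)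
          have hk : (k : ℝ) ^ 2 ≤ ‖(z i).2‖ ^ 2 := pow_le_pow_left₀ (Nat.cast_nonneg k) hz 2
          nlinarith [mul_le_mul_of_nonneg_left hk ha_nn]
        · rw [indicator_of_notMem hz]
          exact bot_le
    _ = (∫⁻ z, ENNReal.ofReal (Real.exp (a * ‖(z i).2‖ ^ 2)) ∂(localGibbsMeasure σ a₀ u₀ θ₀ N)) *
          ENNReal.ofReal (Real.exp (-(a * (k : ℝ) ^ 2))) :=
        lintegral_mul_const _ hG
    _ ≤ K * ENNReal.ofReal (Real.exp (-(a * (k : ℝ) ^ 2))) :=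
        mul_le_mul' (lintegral_exp_localGibbsMeasure_le ha hθ hu ha0 hθ0 hK σ N i) le_rfl

/-! ## The registered stub -/

/-- **S_G1 · `stub_initialTails` (t = 0 sub-Gaussian speed tails under the local Gibbs law).**
For continuous profiles `a₀, θ₀ > 0`, `u₀` there are `κ > 0` and `C < ∞` with
`∑ᵢ λ_N{k ≤ ‖vᵢ‖} ≤ (N + 1) · C · e^{-κ k²}` for every reduced diameter `σ`, every `N`, every
hard-sphere flow `Φ` and every level `k` (`λ_N = localGibbsLaw σ a₀ u₀ θ₀ N Φ = localGibbsMeasure`,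
`localGibbsLaw_eq`): Fernique's uniform one-body exponential moment
(`tailsZero_exists_lintegral_exp_gaussMeasure_le`, `κ = a`, `C = K`), the disintegration of the
local Gibbs law into positions (mass `≤ 1` for every `σ`) and independent Gaussian velocities,
Chebyshev–Markov per particle (`localGibbsMeasure_speed_ge_le`), and the sum over the `N + 1`
particles.  Verbatim the registered stub `stub_initialTails` of stmt-AtomisticToContinuum-14415. -/
theorem stub_initialTails :
    ∀ (a₀ θ₀ : Literature.MathematicalPhysics.KineticTheory.T3 → ℝ)
      (u₀ : Literature.MathematicalPhysics.KineticTheory.T3 → Literature.MathematicalPhysics.KineticTheory.V3),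
      Continuous a₀ → Continuous θ₀ → Continuous u₀ → (∀ x, 0 < a₀ x) → (∀ x, 0 < θ₀ x) →
      ∃ κ : ℝ, 0 < κ ∧ ∃ C : ℝ≥0∞, C < ⊤ ∧
        ∀ (σ : ℝ) (N : ℕ)
          (Φ : Literature.Analysis.FluidPDE.HardSphereFlow
            (Literature.Analysis.FluidPDE.Torus.geometry (Fin 3))
            (Literature.MathematicalPhysics.KineticTheory.hsDiameter σ N) (N + 1))
          (k : ℕ),
          (∑ i : Fin (N + 1),
              Literature.MathematicalPhysics.KineticTheory.localGibbsLaw σ a₀ u₀ θ₀ N Φ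
                {z | (k : ℝ) ≤ ‖(z i).2‖}) ≤
            ((N : ℝ≥0∞) + 1) * C * ENNReal.ofReal (Real.exp (-(κ * (k : ℝ) ^ 2))) := by
  intro a₀ θ₀ u₀ ha hθ hu ha0 hθ0
  obtain ⟨a, ha_pos, K, hK⟩ := tailsZero_exists_lintegral_exp_gaussMeasure_le hθ hu hθ0
  refine ⟨a, ha_pos, ENNReal.ofReal K, ENNReal.ofReal_lt_top, fun σ N Φ k => ?_⟩
  have ha0' : ∀ x, 0 ≤ a₀ x := fun x => (ha0 x).le
  rw [localGibbsLaw_eq]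
  calc ∑ i : Fin (N + 1), localGibbsMeasure σ a₀ u₀ θ₀ N {z | (k : ℝ) ≤ ‖(z i).2‖}
      ≤ ∑ _i : Fin (N + 1), ENNReal.ofReal K * ENNReal.ofReal (Real.exp (-(a * (k : ℝ) ^ 2))) :=
        Finset.sum_le_sum fun i _ =>
          localGibbsMeasure_speed_ge_le ha hθ hu ha0' hθ0 ha_pos.le hK σ N i k
    _ = ((N : ℝ≥0∞) + 1) * ENNReal.ofReal K * ENNReal.ofReal (Real.exp (-(a * (k : ℝ) ^ 2))) := by
        rw [Finset.sum_const, Finset.card_univ, Fintype.card_fin, nsmul_eq_mul, Nat.cast_succ,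
          mul_assoc]

end Summit.AtomisticToContinuum.HydrodynamicLimit.Theorems.TransferEntropyClockInitialTails

end
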